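import Literature.MathematicalPhysics.QuantumFieldTheory.VortexTwistSignFlip
import Literature.MathematicalPhysics.QuantumFieldTheory.ConstructiveQFTWave0Proofs
import Literature.MathematicalPhysics.QuantumFieldTheory.VortexTwistPlaneSymmetry
import HarnessLib

/-!
# Tomboulis's Proposition IV.1 on the one-character ray: `|Z⁻_Λ| ≤ Z_Λ` by reflection positivity

E. T. Tomboulis, *Long distance dynamics in SU(2) lattice gauge theory* (arXiv:0707.2179), Prop. IV.1,
eq. (4.6): with `c_j ≥ 0` for all `j`, `Z⁻_Λ({c_j}) ≤ Z_Λ({c_j})`. The printed proof (App. A §5) takes the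
twist set `𝒱` so that all its plaquettes are bisected by a hyperplane `π`, expands
`∏_{p∈𝒱} [S_p^{1/2} + S_p^1] - ∏_{p∈𝒱} [-S_p^{1/2} + S_p^1] = 2 Σ_{Q ⊂ 𝒱, |Q| odd} ∏_{p∈Q} S_p^{1/2} ∏_{p∈𝒱∖Q} S_p^1`
(eq. (A.17); `S_p^{1/2}`, `S_p^1` the half-integer and integer parts of the character expansion of the
plaquette function), inserts it into `Z - Z⁻` (eq. (A.18)) and concludes: "since `c_j(n) ≥ 0`, all `j`,
every term in the sum (A.18) is manifestly non-negative by RP in `π`, which proves IV.1."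

This file makes that argument a tree theorem in the vocabulary of `TomboulisVortexDecimation`
(`torusZ`, `torusZtw`, `vortexRatio`, `vortexSheet`, `TwistLe`) for the spin cut-off `J = 1` — one
non-trivial character, `S_p^{1/2} = d_{1/2} c_{1/2} χ_{1/2}(U_p) = 2 c_{1/2} Re tr U_p`, `S_p^1 = 1` — on
the even torus `(ℤ/Lℤ)^d`, for twist sets of plaquettes bisected by the reflection hyperplanes of
`ConstructiveQFTWave0Proofs` (the temporal plaquettes based at `t = 0` or `t = L/2`, `IsCrossPlaq`), in
particular for the vortex sheets `vortexSheet L 0 j` in the planes containing the time axis. The general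
spin cut-off needs the Gram (positive-definiteness) structure of all the characters `χ_j(U V†)`, which the
tree does not have yet; the `J = 1` case only needs that of `Re tr (U V†)` (`WilsonRP.coeff`).

## Main statements

* `tTerm c V Q` — the `Q`-term `T_Q = ∫ ∏_{p∉V} f(U_p) ∏_{p∈Q} 2c_{1/2} Re tr U_p ∏ dU` of (A.18);
  `torusZ_sub_torusZtw_one`: `Z - Z⁻_V = 2 Σ_{Q⊆V, |Q| odd} T_Q` and `torusZ_add_torusZtw_one`:
  `Z + Z⁻_V = 2 Σ_{Q⊆V, |Q| even} T_Q` ((A.17)–(A.18); pure algebra, every `V`, every `L`).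
* `tTerm_nonneg` — **the RP step**: `L` even, `c_{1/2} ≥ 0`, `V` crossing, `Q ⊆ V` ⟹ `T_Q ≥ 0`.
* `torusZtw_one_le_torusZ` — **IV.1, eq. (4.6)**: `Z⁻_V ≤ Z`; `neg_torusZ_le_torusZtw_one`: `-Z ≤ Z⁻_V`
  (the reflection positivity of `Z⁺ = (Z + Z⁻)/2`, eq. (4.7), §4.1); `abs_torusZtw_one_le_torusZ`:
  `|Z⁻_V| ≤ Z`; `twistLe_one_vortexSheet : TwistLe d L 1 (vortexSheet L 0 j _)` for even `L`
  (`vortexSheet_isCrossPlaq`); `abs_vortexRatio_one_le_one`: `|Z⁻/Z| ≤ 1`.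

## The reflection-positivity argument (App. A §5 made explicit, after Osterwalder–Seiler)

Setting and machinery of `ConstructiveQFTWave0Proofs` (namespace `WilsonRP`) and `LatticeRPMechanism`:
time is the `0`-th coordinate, `θ t = 1 - t`, positive links `P = posEdges`, crossing links
`C = crossEdges`, `Θ = GaugeConfig.timeReflect`. The integrand of `T_Q` is `∏_p (α_p + β_p Re tr U_p)`
with `(α_p, β_p) = (1, 2c_{1/2})` off `V`, `(0, 2c_{1/2})` on `Q`, `(1, 0)` on `V ∖ Q`
(`tTerm_integrand_eq_prod`), all `≥ 0` when `c_{1/2} ≥ 0`. It splits as `G(U) · G(ΘU) · W_×(U)`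
(`prod_w_split`: positive plaquettes, negative plaquettes = reflected positive ones by
`plaqRe_timeReflect`, crossing plaquettes — this is where `V ⊆ crossing` is used). After the Haar
substitution `translate Y` on the crossing links (measure preserving, `measurePreserving_translate`),
each crossing factor is a Gram kernel `Σ_ι γ_{p,ι} A_{p,ι}(splice_C(U,Y)) conj A_{p,ι}(ΘU)` with
`γ_{p,ι} ∈ {α_p, β_p/2} ≥ 0` and `A_{p,ι} ∈ {1} ∪ {unitarised half-plaquette entries and their conjugates}`
(`cross_factor_gram`, from `plaqRe_translate_of_isCrossPlaq`); expanding the product over crossing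
plaquettes (`Finset.prod_univ_sum`) gives `T_Q = Σ_x Γ_x ∫∫ Φ_x(splice_C(U,Y)) conj Φ_x(ΘU) dμ(U) dμ(Y)`
with `Γ_x ≥ 0` and `Φ_x = G · ∏_p A_{p,x_p}` bounded, measurable and depending only on the links in
`P ∪ C`, and each double integral is `|∫ Φ_x|² ≥ 0` (`LatticeRP.integral_splice_mul_conj_comp_nonneg`).
No gauge fixing and no gauge invariance is used (cf. the module docstring of
`ConstructiveQFTWave0Proofs`).

## References

* E. T. Tomboulis, arXiv:0707.2179, §4 eqs. (4.6)–(4.7), App. A §5 eqs. (A.17)–(A.18)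
  [cite: Tomboulis2007Confinement, Prop. IV.1 eq. (4.6); App. A §5].
* K. Osterwalder, E. Seiler, *Gauge field theories on a lattice*, Ann. Phys. 110 (1978) 440–471, §2
  (reflection positivity in hyperplanes between sites) [cite: OsterwalderSeilerAnnPhys1978, §2].

## Scope notes

Planes not containing the time axis are equivalent by a relabelling of the axes
(`TwistedPartitionFunction.configTranspose`); **Revision 2 (append-only)** imports that transport from
`VortexTwistPlaneSymmetry` (`twistLe_vortexSheet_iff_plane_zero_one` etc.) and records Prop. IV.1 at
`J = 1` for the vortex sheet in EVERY plane of the even torus: `twistLe_one_vortexSheet_plane`,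
`abs_torusZtw_one_vortexSheet_le_torusZ`, `abs_vortexRatio_one_le_one_plane`. Odd `L` has no reflection
hyperplane between slices pairing the plaquettes, and Prop. IV.1 is used in the tree only on even tori.
Nothing here asserts IV.1 for `J ≥ 2`.
-/

noncomputable section

open MeasureTheory Finset Real
open scoped BigOperators ComplexConjugate
open Literature.MathematicalPhysics.QuantumLattice

namespace Literature.MathematicalPhysics.QuantumFieldTheory

namespace Tomboulis2007

open WilsonRP

/-! ### The plaquette variable `Re tr U_p` and the one-character plaquette functions -/

/-- The fundamental representation of `SU(2)`, in the format of the reflection-positivity files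
(plumbing). [folklore] -/
abbrev rhoFund : SU2 →* Matrix (Fin 2) (Fin 2) ℂ := fundamentalRep (Fin 2)

/-- The fundamental representation is continuous (plumbing). [folklore] -/
private theorem continuous_rhoFund : Continuous rhoFund := continuous_fundamentalRep (Fin 2)

variable {d L : ℕ}

/-- `χ_{1/2}(W) = Re tr W` on `SU(2)` (plumbing). [folklore] -/
private theorem su2Char_one_eq (W : SU2) :
    su2Char 1 W = ((W : Matrix (Fin 2) (Fin 2) ℂ).trace).re := by
  simp only [su2Char, Nat.cast_one, Polynomial.Chebyshev.U_one, Polynomial.eval_mul,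
    Polynomial.eval_ofNat, Polynomial.eval_X]
  ring

/-- On the one-character ray `f(U_p) = 1 + 2 c_{1/2} Re tr U_p` (plumbing). [folklore] -/
private theorem plaqFn_one_eq (c : ℕ → ℝ) (U : GaugeConfig d L SU2) (p : Plaquette d L) :
    plaqFn 1 c (plaquetteHolonomy U p.1 p.2.1.1 p.2.1.2) = 1 + 2 * c 1 * plaqRe rhoFund U p := by
  unfold plaqFn plaqRe
  rw [Finset.Icc_self, Finset.sum_singleton, su2Char_one_eq, fundamentalRep_apply]
  norm_num

/-- On the one-character ray `f⁻(U_p) = 1 - 2 c_{1/2} Re tr U_p` (plumbing). [folklore] -/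
private theorem plaqFnTwist_one_eq (c : ℕ → ℝ) (U : GaugeConfig d L SU2) (p : Plaquette d L) :
    plaqFnTwist 1 c (plaquetteHolonomy U p.1 p.2.1.1 p.2.1.2) = 1 - 2 * c 1 * plaqRe rhoFund U p := by
  unfold plaqFnTwist plaqRe
  rw [Finset.Icc_self, Finset.sum_singleton, su2Char_one_eq, fundamentalRep_apply]
  norm_num
  ring

/-- `|Re tr U_p| ≤ 2` (plumbing). [folklore] -/
private theorem abs_plaqRe_two (U : GaugeConfig d L SU2) (p : Plaquette d L) :
    |plaqRe rhoFund U p| ≤ 2 := by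
  exact_mod_cast abs_plaqRe_le rhoFund continuous_rhoFund U p

/-- Measurability of `U ↦ Re tr U_p` (plumbing). [folklore] -/
private theorem measurable_plaqRe_two (p : Plaquette d L) :
    Measurable fun U : GaugeConfig d L SU2 => plaqRe rhoFund U p :=
  measurable_plaqRe rhoFund continuous_rhoFund p

variable [NeZero L]

/-- Bounded measurable real functions on the configuration space are Haar integrable (plumbing).
[folklore] -/
private theorem integrable_of_abs_le {F : GaugeConfig d L SU2 → ℝ} (hF : Measurable F) (K : ℝ)
    (hK : ∀ U, |F U| ≤ K) : Integrable F (Measure.pi fun _ : Edge d L => haarProbability SU2) :=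
  Integrable.of_mem_Icc (-K) K hF.aemeasurable (ae_of_all _ fun U => Set.mem_Icc.mpr (abs_le.mp (hK U)))

omit [NeZero L] in
/-- A product of affine functions of the plaquette variables is measurable (plumbing). [folklore] -/
private theorem measurable_prod_affine (s : Finset (Plaquette d L)) (α β : Plaquette d L → ℝ) :
    Measurable fun U : GaugeConfig d L SU2 => ∏ p ∈ s, (α p + β p * plaqRe rhoFund U p) :=
  Finset.measurable_prod s fun p _ => measurable_const.add (measurable_const.mul (measurable_plaqRe_two p))

omit [NeZero L] in
/-- … and bounded by `∏ (|α_p| + 2|β_p|)` (plumbing). [folklore] -/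
private theorem abs_prod_affine_le (s : Finset (Plaquette d L)) (α β : Plaquette d L → ℝ)
    (U : GaugeConfig d L SU2) :
    |∏ p ∈ s, (α p + β p * plaqRe rhoFund U p)| ≤ ∏ p ∈ s, (|α p| + 2 * |β p|) := by
  rw [Finset.abs_prod]
  refine Finset.prod_le_prod (fun p _ => abs_nonneg _) fun p _ => ?_
  calc |α p + β p * plaqRe rhoFund U p| ≤ |α p| + |β p * plaqRe rhoFund U p| := abs_add_le _ _
    _ = |α p| + |β p| * |plaqRe rhoFund U p| := by rw [abs_mul]
    _ ≤ |α p| + |β p| * 2 := by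
        have := abs_plaqRe_two U p
        have hb := abs_nonneg (β p)
        nlinarith
    _ = |α p| + 2 * |β p| := by ring

/-! ### The twisted-sector expansion `Z ∓ Z⁻ = 2 Σ_{|Q| odd / even} T_Q` (arXiv:0707.2179 App. A §5) -/

/-- **The `Q`-term of Tomboulis's App. A §5 expansion** on the one-character ray:
`T_Q = ∫ ∏_{p ∉ V} f(U_p) · ∏_{p ∈ Q} 2 c_{1/2} χ_{1/2}(U_p) ∏ dU` for `Q ⊆ V`
(arXiv:0707.2179 eqs. (A.17)–(A.18): the integrand of `Z - Z⁻` expanded over the subsets `Q` of the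
twist set with an odd number of half-integer factors `S_p^{1/2}`; here `S_p^{1/2} = 2 c_{1/2} χ_{1/2}`,
`S_p^1 = 1`). [cite: Tomboulis2007Confinement, App. A §5] -/
def tTerm (c : ℕ → ℝ) (V Q : Finset (Plaquette d L)) : ℝ :=
  ∫ U, (∏ p ∈ Vᶜ, (1 + 2 * c 1 * plaqRe rhoFund U p)) * ∏ p ∈ Q, (2 * c 1 * plaqRe rhoFund U p)
    ∂(Measure.pi fun _ : Edge d L => haarProbability SU2)

/-- The `T_Q` integrand is integrable (plumbing). [folklore] -/
private theorem integrable_tTerm (c : ℕ → ℝ) (V Q : Finset (Plaquette d L)) :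
    Integrable (fun U : GaugeConfig d L SU2 =>
      (∏ p ∈ Vᶜ, (1 + 2 * c 1 * plaqRe rhoFund U p)) * ∏ p ∈ Q, (2 * c 1 * plaqRe rhoFund U p))
      (Measure.pi fun _ : Edge d L => haarProbability SU2) := by
  have h2 : ∀ U : GaugeConfig d L SU2, ∏ p ∈ Q, (2 * c 1 * plaqRe rhoFund U p) =
      ∏ p ∈ Q, ((0 : ℝ) + (2 * c 1) * plaqRe rhoFund U p) := fun U =>
    Finset.prod_congr rfl fun p _ => by ring
  have h1 : ∀ U : GaugeConfig d L SU2, ∏ p ∈ Vᶜ, (1 + 2 * c 1 * plaqRe rhoFund U p) =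
      ∏ p ∈ Vᶜ, ((1 : ℝ) + (2 * c 1) * plaqRe rhoFund U p) := fun U => rfl
  simp_rw [h2]
  refine integrable_of_abs_le ((measurable_prod_affine Vᶜ (fun _ => 1) (fun _ => 2 * c 1)).mul
    (measurable_prod_affine Q (fun _ => 0) (fun _ => 2 * c 1)))
    ((∏ p ∈ Vᶜ, (|(1 : ℝ)| + 2 * |2 * c 1|)) * ∏ p ∈ Q, (|(0 : ℝ)| + 2 * |2 * c 1|)) fun U => ?_
  rw [abs_mul]
  exact mul_le_mul (abs_prod_affine_le Vᶜ (fun _ => 1) (fun _ => 2 * c 1) U)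
    (abs_prod_affine_le Q (fun _ => 0) (fun _ => 2 * c 1) U) (abs_nonneg _)
    ((abs_nonneg _).trans (abs_prod_affine_le Vᶜ (fun _ => 1) (fun _ => 2 * c 1) U))

omit [NeZero L] in
/-- `∏_{p∈V}(1 + a_p) - ∏_{p∈V}(1 - a_p) = 2 Σ_{Q ⊆ V, |Q| odd} ∏_{p∈Q} a_p` (arXiv:0707.2179
eq. (A.17)) (plumbing). [folklore] -/
private theorem prod_add_sub_prod_sub (V : Finset (Plaquette d L)) (a : Plaquette d L → ℝ) :
    (∏ p ∈ V, (1 + a p)) - ∏ p ∈ V, (1 - a p) =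
      2 * ∑ Q ∈ V.powerset.filter (fun Q => Odd Q.card), ∏ p ∈ Q, a p := by
  have h1 : ∏ p ∈ V, (1 - a p) = ∑ Q ∈ V.powerset, (-1 : ℝ) ^ Q.card * ∏ p ∈ Q, a p := by
    have : ∏ p ∈ V, (1 - a p) = ∏ p ∈ V, (1 + (-a p)) := Finset.prod_congr rfl fun p _ => by ring
    rw [this, Finset.prod_one_add]
    exact Finset.sum_congr rfl fun Q _ => Finset.prod_neg _
  rw [Finset.prod_one_add, h1, ← Finset.sum_sub_distrib, Finset.sum_filter, Finset.mul_sum]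
  refine Finset.sum_congr rfl fun Q _ => ?_
  split_ifs with hQ
  · rw [hQ.neg_one_pow]; ring
  · rw [(Nat.not_odd_iff_even.mp hQ).neg_one_pow]; ring

omit [NeZero L] in
/-- `∏_{p∈V}(1 + a_p) + ∏_{p∈V}(1 - a_p) = 2 Σ_{Q ⊆ V, |Q| even} ∏_{p∈Q} a_p` (plumbing). [folklore] -/
private theorem prod_add_add_prod_sub (V : Finset (Plaquette d L)) (a : Plaquette d L → ℝ) :
    (∏ p ∈ V, (1 + a p)) + ∏ p ∈ V, (1 - a p) =
      2 * ∑ Q ∈ V.powerset.filter (fun Q => Even Q.card), ∏ p ∈ Q, a p := by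
  have h1 : ∏ p ∈ V, (1 - a p) = ∑ Q ∈ V.powerset, (-1 : ℝ) ^ Q.card * ∏ p ∈ Q, a p := by
    have : ∏ p ∈ V, (1 - a p) = ∏ p ∈ V, (1 + (-a p)) := Finset.prod_congr rfl fun p _ => by ring
    rw [this, Finset.prod_one_add]
    exact Finset.sum_congr rfl fun Q _ => Finset.prod_neg _
  rw [Finset.prod_one_add, h1, ← Finset.sum_add_distrib, Finset.sum_filter, Finset.mul_sum]
  refine Finset.sum_congr rfl fun Q _ => ?_
  split_ifs with hQ
  · rw [hQ.neg_one_pow]; ring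
  · rw [(Nat.not_even_iff_odd.mp hQ).neg_one_pow]; ring

variable (d L)

/-- The untwisted integrand, split along the twist set: `∏_p f(U_p) = ∏_{p∉V} f(U_p) · ∏_{p∈V}(1 + a_p)`
(plumbing). [folklore] -/
private theorem integrand_torusZ_one (c : ℕ → ℝ) (V : Finset (Plaquette d L)) (U : GaugeConfig d L SU2) :
    ∏ p : Plaquette d L, plaqFn 1 c (plaquetteHolonomy U p.1 p.2.1.1 p.2.1.2) =
      (∏ p ∈ Vᶜ, (1 + 2 * c 1 * plaqRe rhoFund U p)) *
        ∏ p ∈ V, (1 + 2 * c 1 * plaqRe rhoFund U p) := by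
  rw [← Finset.prod_mul_prod_compl V, mul_comm]
  simp only [plaqFn_one_eq]

/-- The twisted integrand, split along the twist set: `∏_{p∉V} f(U_p) · ∏_{p∈V}(1 - a_p)` (plumbing).
[folklore] -/
private theorem integrand_torusZtw_one (c : ℕ → ℝ) (V : Finset (Plaquette d L)) (U : GaugeConfig d L SU2) :
    ∏ p : Plaquette d L, (if p ∈ V then plaqFnTwist 1 c (plaquetteHolonomy U p.1 p.2.1.1 p.2.1.2)
        else plaqFn 1 c (plaquetteHolonomy U p.1 p.2.1.1 p.2.1.2)) =
      (∏ p ∈ Vᶜ, (1 + 2 * c 1 * plaqRe rhoFund U p)) *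
        ∏ p ∈ V, (1 - 2 * c 1 * plaqRe rhoFund U p) := by
  rw [← Finset.prod_mul_prod_compl V, mul_comm]
  congr 1
  · exact Finset.prod_congr rfl fun p hp => by
      rw [if_neg (Finset.mem_compl.mp hp), plaqFn_one_eq]
  · exact Finset.prod_congr rfl fun p hp => by rw [if_pos hp, plaqFnTwist_one_eq]

/-- **Tomboulis's expansion of `Z - Z⁻` in odd twisted sectors** (arXiv:0707.2179 App. A §5,
eqs. (A.17)–(A.18)), on the one-character ray: for every torus, coefficient `c_{1/2}` and twist set `V`,
`Z - Z⁻_V = 2 Σ_{Q ⊆ V, |Q| odd} T_Q`. [cite: Tomboulis2007Confinement, App. A §5] -/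
theorem torusZ_sub_torusZtw_one (c : ℕ → ℝ) (V : Finset (Plaquette d L)) :
    torusZ d L 1 c - torusZtw d L 1 c V =
      2 * ∑ Q ∈ V.powerset.filter (fun Q => Odd Q.card), tTerm c V Q := by
  unfold torusZ torusZtw tTerm
  simp_rw [integrand_torusZ_one d L c V, integrand_torusZtw_one d L c V]
  have iA : Integrable (fun U : GaugeConfig d L SU2 => (∏ p ∈ Vᶜ, (1 + 2 * c 1 * plaqRe rhoFund U p)) *
      ∏ p ∈ V, (1 + 2 * c 1 * plaqRe rhoFund U p)) (Measure.pi fun _ : Edge d L => haarProbability SU2) := by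
    refine integrable_of_abs_le ((measurable_prod_affine Vᶜ (fun _ => 1) (fun _ => 2 * c 1)).mul
      (measurable_prod_affine V (fun _ => 1) (fun _ => 2 * c 1)))
      ((∏ p ∈ Vᶜ, (|(1 : ℝ)| + 2 * |2 * c 1|)) * ∏ p ∈ V, (|(1 : ℝ)| + 2 * |2 * c 1|)) fun U => ?_
    rw [abs_mul]
    exact mul_le_mul (abs_prod_affine_le Vᶜ _ _ U) (abs_prod_affine_le V _ _ U) (abs_nonneg _)
      ((abs_nonneg _).trans (abs_prod_affine_le Vᶜ _ _ U))
  have iB : Integrable (fun U : GaugeConfig d L SU2 => (∏ p ∈ Vᶜ, (1 + 2 * c 1 * plaqRe rhoFund U p)) *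
      ∏ p ∈ V, (1 - 2 * c 1 * plaqRe rhoFund U p)) (Measure.pi fun _ : Edge d L => haarProbability SU2) := by
    have h : ∀ U : GaugeConfig d L SU2, ∏ p ∈ V, (1 - 2 * c 1 * plaqRe rhoFund U p) =
        ∏ p ∈ V, ((1 : ℝ) + (-(2 * c 1)) * plaqRe rhoFund U p) := fun U =>
      Finset.prod_congr rfl fun p _ => by ring
    simp_rw [h]
    refine integrable_of_abs_le ((measurable_prod_affine Vᶜ (fun _ => 1) (fun _ => 2 * c 1)).mul
      (measurable_prod_affine V (fun _ => 1) (fun _ => -(2 * c 1))))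
      ((∏ p ∈ Vᶜ, (|(1 : ℝ)| + 2 * |2 * c 1|)) * ∏ p ∈ V, (|(1 : ℝ)| + 2 * |-(2 * c 1)|)) fun U => ?_
    rw [abs_mul]
    exact mul_le_mul (abs_prod_affine_le Vᶜ _ _ U) (abs_prod_affine_le V _ _ U) (abs_nonneg _)
      ((abs_nonneg _).trans (abs_prod_affine_le Vᶜ _ _ U))
  rw [← integral_sub iA iB]
  have hpt : ∀ U : GaugeConfig d L SU2,
      (∏ p ∈ Vᶜ, (1 + 2 * c 1 * plaqRe rhoFund U p)) * ∏ p ∈ V, (1 + 2 * c 1 * plaqRe rhoFund U p) -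
        (∏ p ∈ Vᶜ, (1 + 2 * c 1 * plaqRe rhoFund U p)) * ∏ p ∈ V, (1 - 2 * c 1 * plaqRe rhoFund U p) =
      ∑ Q ∈ V.powerset.filter (fun Q => Odd Q.card),
        2 * ((∏ p ∈ Vᶜ, (1 + 2 * c 1 * plaqRe rhoFund U p)) * ∏ p ∈ Q, (2 * c 1 * plaqRe rhoFund U p)) := by
    intro U
    rw [← mul_sub, prod_add_sub_prod_sub, Finset.mul_sum, Finset.mul_sum]
    exact Finset.sum_congr rfl fun Q _ => by ring
  simp_rw [hpt]
  rw [integral_finsetSum _ (fun Q _ => (integrable_tTerm c V Q).const_mul 2), Finset.mul_sum]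
  exact Finset.sum_congr rfl fun Q _ => integral_const_mul _ _

/-- **The even twisted sectors**: `Z + Z⁻_V = 2 Σ_{Q ⊆ V, |Q| even} T_Q` (same expansion).
[cite: Tomboulis2007Confinement, App. A §5] -/
theorem torusZ_add_torusZtw_one (c : ℕ → ℝ) (V : Finset (Plaquette d L)) :
    torusZ d L 1 c + torusZtw d L 1 c V =
      2 * ∑ Q ∈ V.powerset.filter (fun Q => Even Q.card), tTerm c V Q := by
  unfold torusZ torusZtw tTerm
  simp_rw [integrand_torusZ_one d L c V, integrand_torusZtw_one d L c V]
  have iA : Integrable (fun U : GaugeConfig d L SU2 => (∏ p ∈ Vᶜ, (1 + 2 * c 1 * plaqRe rhoFund U p)) *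
      ∏ p ∈ V, (1 + 2 * c 1 * plaqRe rhoFund U p)) (Measure.pi fun _ : Edge d L => haarProbability SU2) := by
    refine integrable_of_abs_le ((measurable_prod_affine Vᶜ (fun _ => 1) (fun _ => 2 * c 1)).mul
      (measurable_prod_affine V (fun _ => 1) (fun _ => 2 * c 1)))
      ((∏ p ∈ Vᶜ, (|(1 : ℝ)| + 2 * |2 * c 1|)) * ∏ p ∈ V, (|(1 : ℝ)| + 2 * |2 * c 1|)) fun U => ?_
    rw [abs_mul]
    exact mul_le_mul (abs_prod_affine_le Vᶜ _ _ U) (abs_prod_affine_le V _ _ U) (abs_nonneg _)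
      ((abs_nonneg _).trans (abs_prod_affine_le Vᶜ _ _ U))
  have iB : Integrable (fun U : GaugeConfig d L SU2 => (∏ p ∈ Vᶜ, (1 + 2 * c 1 * plaqRe rhoFund U p)) *
      ∏ p ∈ V, (1 - 2 * c 1 * plaqRe rhoFund U p)) (Measure.pi fun _ : Edge d L => haarProbability SU2) := by
    have h : ∀ U : GaugeConfig d L SU2, ∏ p ∈ V, (1 - 2 * c 1 * plaqRe rhoFund U p) =
        ∏ p ∈ V, ((1 : ℝ) + (-(2 * c 1)) * plaqRe rhoFund U p) := fun U =>
      Finset.prod_congr rfl fun p _ => by ring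
    simp_rw [h]
    refine integrable_of_abs_le ((measurable_prod_affine Vᶜ (fun _ => 1) (fun _ => 2 * c 1)).mul
      (measurable_prod_affine V (fun _ => 1) (fun _ => -(2 * c 1))))
      ((∏ p ∈ Vᶜ, (|(1 : ℝ)| + 2 * |2 * c 1|)) * ∏ p ∈ V, (|(1 : ℝ)| + 2 * |-(2 * c 1)|)) fun U => ?_
    rw [abs_mul]
    exact mul_le_mul (abs_prod_affine_le Vᶜ _ _ U) (abs_prod_affine_le V _ _ U) (abs_nonneg _)
      ((abs_nonneg _).trans (abs_prod_affine_le Vᶜ _ _ U))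
  rw [← integral_add iA iB]
  have hpt : ∀ U : GaugeConfig d L SU2,
      (∏ p ∈ Vᶜ, (1 + 2 * c 1 * plaqRe rhoFund U p)) * ∏ p ∈ V, (1 + 2 * c 1 * plaqRe rhoFund U p) +
        (∏ p ∈ Vᶜ, (1 + 2 * c 1 * plaqRe rhoFund U p)) * ∏ p ∈ V, (1 - 2 * c 1 * plaqRe rhoFund U p) =
      ∑ Q ∈ V.powerset.filter (fun Q => Even Q.card),
        2 * ((∏ p ∈ Vᶜ, (1 + 2 * c 1 * plaqRe rhoFund U p)) * ∏ p ∈ Q, (2 * c 1 * plaqRe rhoFund U p)) := by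
    intro U
    rw [← mul_add, prod_add_add_prod_sub, Finset.mul_sum, Finset.mul_sum]
    exact Finset.sum_congr rfl fun Q _ => by ring
  simp_rw [hpt]
  rw [integral_finsetSum _ (fun Q _ => (integrable_tTerm c V Q).const_mul 2), Finset.mul_sum]
  exact Finset.sum_congr rfl fun Q _ => integral_const_mul _ _

/-! ### Reflection positivity of the twisted sectors (arXiv:0707.2179 App. A §5)

Setting of `ConstructiveQFTWave0Proofs`: the even torus, the reflection `θ t = 1 - t` in the hyperplanes
between the time slices `t = 0, 1` and `t = L/2, L/2 + 1`, positive links `P = posEdges`, crossing links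
`C = crossEdges`, crossing plaquettes `IsCrossPlaq` (the temporal plaquettes based at `t = 0` or
`t = L/2` — the plaquettes "bisected by the hyperplane `π`" of Tomboulis's App. A §5). -/

section RP

variable {d L}
variable [NeZero d] [Fact (1 < L)]

/-- The constant part of the plaquette weight in the `Q`-term: `0` on `Q`, `1` elsewhere (plumbing). [folklore] -/
private def wα (V Q : Finset (Plaquette d L)) (p : Plaquette d L) : ℝ :=
  if p ∈ V then (if p ∈ Q then 0 else 1) else 1

/-- The `Re tr`-coefficient of the plaquette weight in the `Q`-term: `2c` off `V` and on `Q`, `0` on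
`V \ Q` (plumbing). [folklore] -/
private def wβ (c : ℕ → ℝ) (V Q : Finset (Plaquette d L)) (p : Plaquette d L) : ℝ :=
  if p ∈ V then (if p ∈ Q then 2 * c 1 else 0) else 2 * c 1

omit [NeZero L] [NeZero d] [Fact (1 < L)] in
/-- `α_p ≥ 0` (plumbing). [folklore] -/
private theorem wα_nonneg (V Q : Finset (Plaquette d L)) (p : Plaquette d L) : 0 ≤ wα V Q p := by
  unfold wα; split_ifs <;> norm_num

omit [NeZero L] [NeZero d] [Fact (1 < L)] in
/-- `β_p ≥ 0` when `c_{1/2} ≥ 0` (plumbing). [folklore] -/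
private theorem wβ_nonneg {c : ℕ → ℝ} (hc : 0 ≤ c 1) (V Q : Finset (Plaquette d L)) (p : Plaquette d L) :
    0 ≤ wβ c V Q p := by
  unfold wβ; split_ifs <;> linarith

omit [NeZero d] [Fact (1 < L)] in
/-- The `Q`-term integrand as a product of affine plaquette weights over ALL plaquettes (plumbing).
[folklore] -/
private theorem tTerm_integrand_eq_prod (c : ℕ → ℝ) {V Q : Finset (Plaquette d L)} (hQ : Q ⊆ V)
    (U : GaugeConfig d L SU2) :
    (∏ p ∈ Vᶜ, (1 + 2 * c 1 * plaqRe rhoFund U p)) * ∏ p ∈ Q, (2 * c 1 * plaqRe rhoFund U p) =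
      ∏ p : Plaquette d L, (wα V Q p + wβ c V Q p * plaqRe rhoFund U p) := by
  rw [← Finset.prod_mul_prod_compl V (fun p => wα V Q p + wβ c V Q p * plaqRe rhoFund U p),
    ← Finset.prod_sdiff hQ, mul_comm]
  have h1 : ∏ p ∈ V \ Q, (wα V Q p + wβ c V Q p * plaqRe rhoFund U p) = 1 :=
    Finset.prod_eq_one fun p hp => by
      obtain ⟨hpV, hpQ⟩ := Finset.mem_sdiff.mp hp
      simp [wα, wβ, hpV, hpQ]
  have h2 : ∏ p ∈ Q, (wα V Q p + wβ c V Q p * plaqRe rhoFund U p) =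
      ∏ p ∈ Q, (2 * c 1 * plaqRe rhoFund U p) :=
    Finset.prod_congr rfl fun p hp => by simp [wα, wβ, hQ hp, hp]
  have h3 : ∏ p ∈ Vᶜ, (wα V Q p + wβ c V Q p * plaqRe rhoFund U p) =
      ∏ p ∈ Vᶜ, (1 + 2 * c 1 * plaqRe rhoFund U p) :=
    Finset.prod_congr rfl fun p hp => by simp [wα, wβ, Finset.mem_compl.mp hp]
  rw [h1, one_mul, h2, h3, mul_comm]

/-- The positive-time part of the weight: `G(U) = ∏_{p positive} f(U_p)` (plumbing). [folklore] -/
private def gPos (c : ℕ → ℝ) (W : GaugeConfig d L SU2) : ℝ :=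
  ∏ p ∈ univ.filter IsPosPlaq, (1 + 2 * c 1 * plaqRe rhoFund W p)

/-- The crossing part of the weight in the `Q`-term (plumbing). [folklore] -/
private def wCross (c : ℕ → ℝ) (V Q : Finset (Plaquette d L)) (W : GaugeConfig d L SU2) : ℝ :=
  ∏ p ∈ univ.filter IsCrossPlaq, (wα V Q p + wβ c V Q p * plaqRe rhoFund W p)

/-- **The negative plaquettes are the reflected positive ones**: `∏_{p neg} φ(Re tr U_p) =
∏_{p pos} φ(Re tr (ΘU)_p)` (the reflection maps positive to negative plaquettes bijectively, with
`Re tr (ΘU)_p = Re tr U_{ϑp}`) (plumbing). [folklore] -/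
private theorem prod_neg_eq_prod_pos_timeReflect (hL : Even L) (φ : ℝ → ℝ) (U : GaugeConfig d L SU2) :
    ∏ p ∈ univ.filter IsNegPlaq, φ (plaqRe rhoFund U p) =
      ∏ p ∈ univ.filter IsPosPlaq, φ (plaqRe rhoFund U.timeReflect p) := by
  simp_rw [plaqRe_timeReflect rhoFund continuous_rhoFund]
  symm
  refine Finset.prod_equiv plaqReflectEquiv (fun p => ?_) (fun p _ => rfl)
  simp only [Finset.mem_filter, Finset.mem_univ, true_and]
  exact (isNegPlaq_plaqReflect_iff hL p).symm

/-- Splitting the `Q`-term integrand into positive, reflected-positive and crossing parts: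
`∏_p w_p(U) = G(U) · G(ΘU) · W_×(U)` when the twist set consists of crossing plaquettes (plumbing).
[folklore] -/
private theorem prod_w_split (hL : Even L) (c : ℕ → ℝ) {V Q : Finset (Plaquette d L)}
    (hV : ∀ p ∈ V, IsCrossPlaq p) (U : GaugeConfig d L SU2) :
    ∏ p : Plaquette d L, (wα V Q p + wβ c V Q p * plaqRe rhoFund U p) =
      gPos c U * gPos c U.timeReflect * wCross c V Q U := by
  rw [← Finset.prod_filter_mul_prod_filter_not univ IsCrossPlaq, mul_comm]
  unfold wCross gPos
  congr 1
  -- the non-crossing plaquettes: positive and negative ones, all with the weight `f`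
  have hw : ∀ p ∈ univ.filter (fun p => ¬ IsCrossPlaq p),
      wα V Q p + wβ c V Q p * plaqRe rhoFund U p = 1 + 2 * c 1 * plaqRe rhoFund U p := by
    intro p hp
    have hpV : p ∉ V := fun h => (Finset.mem_filter.mp hp).2 (hV p h)
    simp [wα, wβ, hpV]
  rw [Finset.prod_congr rfl hw,
    ← Finset.prod_filter_mul_prod_filter_not (univ.filter fun p => ¬ IsCrossPlaq p) IsPosPlaq,
    Finset.filter_filter, Finset.filter_filter]
  have hpos : univ.filter (fun p : Plaquette d L => ¬ IsCrossPlaq p ∧ IsPosPlaq p) = univ.filter IsPosPlaq :=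
    Finset.filter_congr fun p _ =>
      ⟨fun h => h.2, fun h => ⟨fun hc => not_isPosPlaq_of_isCrossPlaq hL hc h, h⟩⟩
  have hneg : univ.filter (fun p : Plaquette d L => ¬ IsCrossPlaq p ∧ ¬ IsPosPlaq p) = univ.filter IsNegPlaq :=
    Finset.filter_congr fun p _ => ⟨fun h => ⟨h.2, h.1⟩, fun h => ⟨h.2, h.1⟩⟩
  have h4 := prod_neg_eq_prod_pos_timeReflect hL (fun r => 1 + 2 * c 1 * r) U
  beta_reduce at h4
  rw [hpos, hneg, h4]

/-! #### The Gram structure of the crossing weights after splitting the crossing links -/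

/-- Index of the Gram expansion of one plaquette weight: the constant term, or a matrix entry of the
half-plaquette (and whether it or its conjugate is taken) (plumbing). [folklore] -/
private abbrev GramIdx : Type := Option (Fin 2 × Fin 2 × Bool)

/-- The nonnegative weights of the Gram expansion (plumbing). [folklore] -/
private def gramW (c : ℕ → ℝ) (V Q : Finset (Plaquette d L)) (p : Plaquette d L) : GramIdx → ℝ
  | none => if IsCrossPlaq p then wα V Q p else 1
  | some _ => if IsCrossPlaq p then wβ c V Q p / 2 else 0

/-- The functions of the Gram expansion: `1`, and the (conjugated) unitarised half-plaquette entries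
`coeff` of `ConstructiveQFTWave0Proofs` at `β = 2` (plumbing). [folklore] -/
private def gramA (p : Plaquette d L) : GramIdx → GaugeConfig d L SU2 → ℂ
  | none => fun _ => 1
  | some klb => coeff rhoFund continuous_rhoFund 2 (p, klb)

omit [NeZero L] [Fact (1 < L)] in
/-- The Gram weights are nonnegative when `c_{1/2} ≥ 0` (plumbing). [folklore] -/
private theorem gramW_nonneg {c : ℕ → ℝ} (hc : 0 ≤ c 1) (V Q : Finset (Plaquette d L))
    (p : Plaquette d L) (j : GramIdx) : 0 ≤ gramW c V Q p j := by
  cases j with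
  | none => simp only [gramW]; split_ifs; exacts [wα_nonneg V Q p, zero_le_one]
  | some _ => simp only [gramW]; split_ifs; exacts [div_nonneg (wβ_nonneg hc V Q p) two_pos.le, le_rfl]

omit [NeZero L] [Fact (1 < L)] in
/-- The Gram functions are measurable (plumbing). [folklore] -/
private theorem measurable_gramA (p : Plaquette d L) (j : GramIdx) : Measurable (gramA p j) := by
  cases j with
  | none => exact measurable_const
  | some klb => exact measurable_coeff rhoFund continuous_rhoFund 2 (p, klb)

omit [NeZero L] [Fact (1 < L)] in
/-- The Gram functions are bounded by `1` (plumbing). [folklore] -/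
private theorem norm_gramA_le (p : Plaquette d L) (j : GramIdx) (W : GaugeConfig d L SU2) :
    ‖gramA p j W‖ ≤ 1 := by
  cases j with
  | none => simp [gramA]
  | some klb =>
    have h := norm_coeff_le rhoFund continuous_rhoFund 2 (p, klb) W
    have h1 : Real.sqrt (2 / 2) = 1 := by norm_num
    simpa [gramA, h1] using h

/-- The Gram functions depend only on the links in `P ∪ C` (plumbing). [folklore] -/
private theorem dependsOn_gramA (hL : Even L) (p : Plaquette d L) (j : GramIdx) :
    DependsOn (gramA p j) ((posEdges ∪ crossEdges : Finset (Edge d L)) : Set (Edge d L)) := by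
  cases j with
  | none => intro U W _; rfl
  | some klb => exact dependsOn_coeff rhoFund hL continuous_rhoFund 2 (p, klb)

/-- `2 Re(u conj v) = u conj v + conj u · conj(conj v)`, weighted (plumbing). [folklore] -/
private theorem gram_key (u v : ℂ) (w : ℝ) :
    (w : ℂ) * (((u * conj v).re : ℝ) : ℂ) =
      (w : ℂ) / 2 * (u * conj v) + (w : ℂ) / 2 * (conj u * conj (conj v)) := by
  rw [Complex.re_eq_add_conj]
  simp only [map_mul, Complex.conj_conj]
  ring

/-- **The Gram identity for one crossing plaquette**: after the substitution `translate Y`, the weight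
`α_p + β_p Re tr U_p` of a crossing plaquette is `Σ_j γ_{p,j} A_{p,j}(z) conj A_{p,j}(ΘU)` with
`γ ≥ 0`, `z = splice_C(U, Y)` (plumbing, from `plaqRe_translate_of_isCrossPlaq`). [folklore] -/
private theorem cross_factor_gram (hL : Even L) (c : ℕ → ℝ) (V Q : Finset (Plaquette d L))
    (U Y : GaugeConfig d L SU2) {p : Plaquette d L} (hp : IsCrossPlaq p) :
    (((wα V Q p + wβ c V Q p * plaqRe rhoFund (translate Y U) p : ℝ)) : ℂ) =
      ∑ j : GramIdx, ((gramW c V Q p j : ℝ) : ℂ) *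
        (gramA p j (LatticeRP.splice crossEdges (U, Y)) * conj (gramA p j U.timeReflect)) := by
  rw [plaqRe_translate_of_isCrossPlaq rhoFund hL continuous_rhoFund U Y hp, Fintype.sum_option]
  simp only [gramW, gramA, if_pos hp, map_one, mul_one]
  push_cast
  rw [Finset.mul_sum]
  congr 1
  rw [Fintype.sum_prod_type]
  refine Finset.sum_congr rfl fun k _ => ?_
  rw [Finset.mul_sum, Fintype.sum_prod_type]
  refine Finset.sum_congr rfl fun l _ => ?_
  rw [Fintype.sum_bool]
  have h1 : (Real.sqrt (2 / 2) : ℂ) = 1 := by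
    rw [show (2 : ℝ) / 2 = 1 by norm_num, Real.sqrt_one]; simp
  simp only [coeff, if_pos hp, ↓reduceIte, Bool.false_eq_true, h1, one_mul]
  exact gram_key _ _ _

/-- The crossing weight, after `translate Y`, as a sum of Gram products over all index choices
(plumbing). [folklore] -/
private theorem wCross_translate_gram (hL : Even L) (c : ℕ → ℝ) (V Q : Finset (Plaquette d L))
    (U Y : GaugeConfig d L SU2) :
    ((wCross c V Q (translate Y U) : ℝ) : ℂ) =
      ∑ x ∈ Fintype.piFinset (fun _ : Plaquette d L => (univ : Finset GramIdx)),
        ((∏ p, gramW c V Q p (x p) : ℝ) : ℂ) *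
          ((∏ p, gramA p (x p) (LatticeRP.splice crossEdges (U, Y))) *
            conj (∏ p, gramA p (x p) U.timeReflect)) := by
  unfold wCross
  rw [Finset.prod_filter, Complex.ofReal_prod]
  have hfac : ∀ p : Plaquette d L,
      (((if IsCrossPlaq p then wα V Q p + wβ c V Q p * plaqRe rhoFund (translate Y U) p else 1 : ℝ)) : ℂ) =
        ∑ j : GramIdx, ((gramW c V Q p j : ℝ) : ℂ) *
          (gramA p j (LatticeRP.splice crossEdges (U, Y)) * conj (gramA p j U.timeReflect)) := by
    intro p
    by_cases hp : IsCrossPlaq p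
    · rw [if_pos hp]; exact cross_factor_gram hL c V Q U Y hp
    · rw [if_neg hp, Fintype.sum_option]; simp [gramW, gramA, hp]
  simp_rw [hfac]
  rw [Finset.prod_univ_sum]
  refine Finset.sum_congr rfl fun x _ => ?_
  rw [Finset.prod_mul_distrib, Finset.prod_mul_distrib, Complex.ofReal_prod, map_prod]

/-! #### Assembly: `T_Q ≥ 0` -/

/-- `Γ_x = ∏_p γ_{p, x_p}` (plumbing). [folklore] -/
private def gramΓ (c : ℕ → ℝ) (V Q : Finset (Plaquette d L)) (x : Plaquette d L → GramIdx) : ℝ :=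
  ∏ p, gramW c V Q p (x p)

/-- `Φ_x(W) = G(W) ∏_p A_{p, x_p}(W)` (plumbing). [folklore] -/
private def gramΦ (c : ℕ → ℝ) (x : Plaquette d L → GramIdx) (W : GaugeConfig d L SU2) : ℂ :=
  (gPos c W : ℂ) * ∏ p, gramA p (x p) W

omit [Fact (1 < L)] in
/-- `Γ_x ≥ 0` when `c_{1/2} ≥ 0` (plumbing). [folklore] -/
private theorem gramΓ_nonneg {c : ℕ → ℝ} (hc : 0 ≤ c 1) (V Q : Finset (Plaquette d L))
    (x : Plaquette d L → GramIdx) : 0 ≤ gramΓ c V Q x :=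
  Finset.prod_nonneg fun p _ => gramW_nonneg hc V Q p (x p)

omit [Fact (1 < L)] in
/-- `G` is measurable (plumbing). [folklore] -/
private theorem measurable_gPos (c : ℕ → ℝ) : Measurable (gPos (d := d) (L := L) c) :=
  measurable_prod_affine _ (fun _ => 1) (fun _ => 2 * c 1)

omit [Fact (1 < L)] in
/-- `G` is bounded (plumbing). [folklore] -/
private theorem abs_gPos_le (c : ℕ → ℝ) (W : GaugeConfig d L SU2) :
    |gPos c W| ≤ ∏ _p ∈ (univ : Finset (Plaquette d L)).filter IsPosPlaq, (|(1 : ℝ)| + 2 * |2 * c 1|) :=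
  abs_prod_affine_le _ (fun _ => 1) (fun _ => 2 * c 1) W

/-- `G` depends only on the positive links (product version of `dependsOn_posAction`) (plumbing).
[folklore] -/
private theorem dependsOn_gPos (c : ℕ → ℝ) :
    DependsOn (gPos (d := d) (L := L) c) ((posEdges : Finset (Edge d L)) : Set (Edge d L)) := by
  intro U W hUW
  unfold gPos
  refine Finset.prod_congr rfl fun p hp => ?_
  rw [Finset.mem_filter] at hp
  obtain ⟨h1, h2, h3, h4⟩ := isPosEdge_of_isPosPlaq hp.2
  have h : ∀ e, IsPosEdge e → U e = W e := fun e he => hUW e (by simpa using he)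
  simp only [plaqRe, plaquetteHolonomy, h _ h1, h _ h2, h _ h3, h _ h4]

omit [Fact (1 < L)] in
/-- `Φ_x` is measurable (plumbing). [folklore] -/
private theorem measurable_gramΦ (c : ℕ → ℝ) (x : Plaquette d L → GramIdx) : Measurable (gramΦ c x) :=
  (Complex.measurable_ofReal.comp (measurable_gPos c)).mul
    (Finset.measurable_prod _ fun p _ => measurable_gramA p (x p))

omit [Fact (1 < L)] in
/-- `Φ_x` is bounded (plumbing). [folklore] -/
private theorem norm_gramΦ_le (c : ℕ → ℝ) (x : Plaquette d L → GramIdx) (W : GaugeConfig d L SU2) :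
    ‖gramΦ c x W‖ ≤ ∏ _p ∈ (univ : Finset (Plaquette d L)).filter IsPosPlaq, (|(1 : ℝ)| + 2 * |2 * c 1|) := by
  unfold gramΦ
  rw [norm_mul, Complex.norm_real, Real.norm_eq_abs]
  have h1 : ‖∏ p, gramA p (x p) W‖ ≤ 1 := by
    rw [norm_prod]
    exact Finset.prod_le_one (fun p _ => norm_nonneg _) fun p _ => norm_gramA_le p (x p) W
  calc |gPos c W| * ‖∏ p, gramA p (x p) W‖ ≤ |gPos c W| * 1 :=
        mul_le_mul_of_nonneg_left h1 (abs_nonneg _)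
    _ ≤ _ := by rw [mul_one]; exact abs_gPos_le c W

/-- `Φ_x` depends only on the links in `P ∪ C` (plumbing). [folklore] -/
private theorem dependsOn_gramΦ (hL : Even L) (c : ℕ → ℝ) (x : Plaquette d L → GramIdx) :
    DependsOn (gramΦ c x) ((posEdges ∪ crossEdges : Finset (Edge d L)) : Set (Edge d L)) := by
  intro U W hUW
  have hP : ∀ e ∈ ((posEdges : Finset (Edge d L)) : Set (Edge d L)), U e = W e := fun e he =>
    hUW e (by rw [Finset.coe_union]; exact Or.inl he)
  unfold gramΦ
  rw [dependsOn_gPos c hP]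
  congr 1
  exact Finset.prod_congr rfl fun p _ => dependsOn_gramA hL p (x p) hUW

/-- The doubled integrand `R(U, Y) = Σ_x Γ_x Φ_x(z) conj Φ_x(ΘU)` (plumbing). [folklore] -/
private def gramR (c : ℕ → ℝ) (V Q : Finset (Plaquette d L))
    (q : GaugeConfig d L SU2 × GaugeConfig d L SU2) : ℂ :=
  ∑ x ∈ Fintype.piFinset (fun _ : Plaquette d L => (univ : Finset GramIdx)),
    ((gramΓ c V Q x : ℝ) : ℂ) * (gramΦ c x (LatticeRP.splice crossEdges q) * conj (gramΦ c x q.1.timeReflect))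

/-- **The pointwise identity**: after the substitution `translate Y`, the `Q`-term integrand is the
doubled Gram integrand `R(U, Y)` (plumbing). [folklore] -/
private theorem integrand_translate (hL : Even L) (c : ℕ → ℝ) {V Q : Finset (Plaquette d L)}
    (hV : ∀ p ∈ V, IsCrossPlaq p) (hQ : Q ⊆ V) (U Y : GaugeConfig d L SU2) :
    ((((∏ p ∈ Vᶜ, (1 + 2 * c 1 * plaqRe rhoFund (translate Y U) p)) *
        ∏ p ∈ Q, (2 * c 1 * plaqRe rhoFund (translate Y U) p) : ℝ)) : ℂ) = gramR c V Q (U, Y) := by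
  have hPC : ∀ e : Edge d L, IsPosEdge e → ¬ IsCrossEdge e :=
    fun e he hc => not_isPosEdge_of_isCrossEdge hL hc he
  have hmem : ∀ e : Edge d L, e ∈ ((posEdges : Finset (Edge d L)) : Set (Edge d L)) → IsPosEdge e :=
    fun e he => by simpa using he
  have htr : ∀ e ∈ ((posEdges : Finset (Edge d L)) : Set (Edge d L)), translate Y U e = U e :=
    fun e he => translate_apply_of_not_isCrossEdge Y U (hPC e (hmem e he))
  have hsp : ∀ e ∈ ((posEdges : Finset (Edge d L)) : Set (Edge d L)),
      LatticeRP.splice crossEdges (U, Y) e = U e :=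
    fun e he => splice_apply_of_not_isCrossEdge U Y (hPC e (hmem e he))
  have hΘtr : ∀ e ∈ ((posEdges : Finset (Edge d L)) : Set (Edge d L)),
      (translate Y U).timeReflect e = U.timeReflect e := by
    intro e he
    rw [timeReflect_apply, timeReflect_apply,
      translate_apply_of_not_isCrossEdge Y U (not_isCrossEdge_edgeReflect hL (hmem e he))]
  have hG1 : gPos c (translate Y U) = gPos c (LatticeRP.splice crossEdges (U, Y)) := by
    rw [dependsOn_gPos c htr, ← dependsOn_gPos c hsp]
  have hG2 : gPos c (translate Y U).timeReflect = gPos c U.timeReflect := dependsOn_gPos c hΘtr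
  rw [tTerm_integrand_eq_prod c hQ, prod_w_split hL c hV, Complex.ofReal_mul, Complex.ofReal_mul,
    wCross_translate_gram hL c V Q U Y, hG1, hG2, Finset.mul_sum]
  unfold gramR gramΓ gramΦ
  refine Finset.sum_congr rfl fun x _ => ?_
  simp only [map_mul, Complex.conj_ofReal]
  ring

omit [Fact (1 < L)] in
/-- The doubled integrand is measurable (plumbing). [folklore] -/
private theorem measurable_gramR (c : ℕ → ℝ) (V Q : Finset (Plaquette d L)) : Measurable (gramR c V Q) := by
  unfold gramR
  refine Finset.measurable_sum _ fun x _ => ?_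
  have hΦ := measurable_gramΦ c x
  exact measurable_const.mul ((hΦ.comp (LatticeRP.measurable_splice _)).mul
    (Complex.continuous_conj.measurable.comp (hΦ.comp (measurable_timeReflect.comp measurable_fst))))

omit [Fact (1 < L)] in
/-- Uniform bound on the doubled integrand (plumbing). [folklore] -/
private theorem norm_gramR_le (c : ℕ → ℝ) (V Q : Finset (Plaquette d L))
    (q : GaugeConfig d L SU2 × GaugeConfig d L SU2) :
    ‖gramR c V Q q‖ ≤ ∑ x ∈ Fintype.piFinset (fun _ : Plaquette d L => (univ : Finset GramIdx)),
      |gramΓ c V Q x| *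
        ((∏ _p ∈ (univ : Finset (Plaquette d L)).filter IsPosPlaq, (|(1 : ℝ)| + 2 * |2 * c 1|)) *
          ∏ _p ∈ (univ : Finset (Plaquette d L)).filter IsPosPlaq, (|(1 : ℝ)| + 2 * |2 * c 1|)) := by
  unfold gramR
  refine (norm_sum_le _ _).trans (Finset.sum_le_sum fun x _ => ?_)
  rw [norm_mul, Complex.norm_real, Real.norm_eq_abs, norm_mul, Complex.norm_conj]
  exact mul_le_mul_of_nonneg_left (mul_le_mul (norm_gramΦ_le c x (LatticeRP.splice crossEdges q))
    (norm_gramΦ_le c x q.1.timeReflect) (norm_nonneg _)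
    ((norm_nonneg _).trans (norm_gramΦ_le c x (LatticeRP.splice crossEdges q)))) (abs_nonneg _)

open scoped ComplexOrder in
/-- **Reflection positivity of the twisted sectors** (arXiv:0707.2179 App. A §5: "every term in the
sum (A.18) is manifestly non-negative by RP in `π`"): on the even torus, for `c_{1/2} ≥ 0`, a twist set
`V` of plaquettes bisected by the reflection hyperplanes and every `Q ⊆ V`, `T_Q ≥ 0`. Proof after
Osterwalder–Seiler, with the machinery of `ConstructiveQFTWave0Proofs` / `LatticeRPMechanism`: split the
crossing links by Haar invariance (`translate`), write each crossing weight `α_p + β_p Re tr U_p`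
(`α_p, β_p ≥ 0`) as a Gram kernel in the unitarised half-plaquette entries, expand the product, and
apply `LatticeRP.integral_splice_mul_conj_comp_nonneg` termwise.
[cite: Tomboulis2007Confinement, App. A §5] -/
theorem tTerm_nonneg (hL : Even L) {c : ℕ → ℝ} (hc : 0 ≤ c 1) {V Q : Finset (Plaquette d L)}
    (hV : ∀ p ∈ V, IsCrossPlaq p) (hQ : Q ⊆ V) : 0 ≤ tTerm c V Q := by
  set μ : Measure (GaugeConfig d L SU2) := LatticeRP.piMeasure (haarProbability SU2) with hμ
  -- the real integrand and its complexification
  set H : GaugeConfig d L SU2 → ℝ := fun U =>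
    (∏ p ∈ Vᶜ, (1 + 2 * c 1 * plaqRe rhoFund U p)) * ∏ p ∈ Q, (2 * c 1 * plaqRe rhoFund U p) with hH
  have hHm : Measurable H := by
    have h2 : H = fun U => (∏ p ∈ Vᶜ, ((1 : ℝ) + (2 * c 1) * plaqRe rhoFund U p)) *
        ∏ p ∈ Q, ((0 : ℝ) + (2 * c 1) * plaqRe rhoFund U p) := by
      funext U
      simp only [hH, zero_add]
    rw [h2]
    exact (measurable_prod_affine Vᶜ _ _).mul (measurable_prod_affine Q _ _)
  have hHcm : Measurable fun U => ((H U : ℝ) : ℂ) := Complex.measurable_ofReal.comp hHm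
  -- it suffices to prove positivity of the complexified integral
  suffices key : 0 ≤ ∫ U, ((H U : ℝ) : ℂ) ∂μ by
    rw [integral_complex_ofReal] at key
    exact Complex.zero_le_real.1 key
  have hR : ∀ U Y, ((H (WilsonRP.translate Y U) : ℝ) : ℂ) = gramR c V Q (U, Y) :=
    fun U Y => integrand_translate hL c hV hQ U Y
  have hRi : Integrable (gramR c V Q) (μ.prod μ) :=
    Integrable.of_bound (measurable_gramR c V Q).aestronglyMeasurable _
      (ae_of_all _ (norm_gramR_le c V Q))
  -- Step 1 (splitting the crossing links): `∫ H dμ = ∫∫ R(U, Y) dμ(U) dμ(Y)`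
  have step1 : ∫ U, ((H U : ℝ) : ℂ) ∂μ = ∫ Y, ∫ U, gramR c V Q (U, Y) ∂μ ∂μ := by
    have hY : ∀ Y, ∫ U, ((H U : ℝ) : ℂ) ∂μ = ∫ U, gramR c V Q (U, Y) ∂μ := fun Y => by
      rw [← LatticeRP.integral_comp_eq_of_measurePreserving (measurePreserving_translate Y) hHcm]
      exact integral_congr_ae (ae_of_all _ fun U => hR U Y)
    calc ∫ U, ((H U : ℝ) : ℂ) ∂μ = ∫ _Y, (∫ U, ((H U : ℝ) : ℂ) ∂μ) ∂μ := by
          rw [integral_const, probReal_univ, one_smul]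
      _ = ∫ Y, ∫ U, gramR c V Q (U, Y) ∂μ ∂μ := integral_congr_ae (ae_of_all _ hY)
  rw [step1, ← integral_prod_symm _ hRi]
  -- Step 2 (Gram expansion): each term is `Γ_x · ∫∫ Φ_x(splice) conj Φ_x(Θ U) ≥ 0`
  have hterm : ∀ x ∈ Fintype.piFinset (fun _ : Plaquette d L => (univ : Finset GramIdx)),
      Integrable (fun q : GaugeConfig d L SU2 × GaugeConfig d L SU2 =>
        ((gramΓ c V Q x : ℝ) : ℂ) * (gramΦ c x (LatticeRP.splice crossEdges q) *
          conj (gramΦ c x q.1.timeReflect))) (μ.prod μ) := by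
    intro x _
    have hΦ := measurable_gramΦ c x
    refine Integrable.of_bound (measurable_const.mul ((hΦ.comp (LatticeRP.measurable_splice _)).mul
      (Complex.continuous_conj.measurable.comp
        (hΦ.comp (measurable_timeReflect.comp measurable_fst))))).aestronglyMeasurable
      (|gramΓ c V Q x| *
        ((∏ _p ∈ (univ : Finset (Plaquette d L)).filter IsPosPlaq, (|(1 : ℝ)| + 2 * |2 * c 1|)) *
          ∏ _p ∈ (univ : Finset (Plaquette d L)).filter IsPosPlaq, (|(1 : ℝ)| + 2 * |2 * c 1|)))
      (ae_of_all _ fun q => ?_)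
    rw [norm_mul, Complex.norm_real, Real.norm_eq_abs, norm_mul, Complex.norm_conj]
    exact mul_le_mul_of_nonneg_left (mul_le_mul (norm_gramΦ_le c x (LatticeRP.splice crossEdges q))
      (norm_gramΦ_le c x q.1.timeReflect) (norm_nonneg _)
      ((norm_nonneg _).trans (norm_gramΦ_le c x (LatticeRP.splice crossEdges q)))) (abs_nonneg _)
  unfold gramR
  rw [integral_finsetSum _ hterm]
  refine Finset.sum_nonneg fun x _ => ?_
  rw [integral_const_mul]
  refine mul_nonneg (Complex.zero_le_real.2 (by exact_mod_cast gramΓ_nonneg hc V Q x)) ?_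
  exact LatticeRP.integral_splice_mul_conj_comp_nonneg (haarProbability SU2) posEdges crossEdges
    GaugeConfig.timeReflect measurePreserving_timeReflect
    (fun e he => dependsOn_timeReflect_apply hL e he) (measurable_gramΦ c x) (norm_gramΦ_le c x)
    (dependsOn_gramΦ hL c x)

/-! ### Prop. IV.1 on the one-character ray -/

/-- **Tomboulis's Prop. IV.1 on the one-character ray** (arXiv:0707.2179 eq. (4.6), proof App. A §5):
on the even torus `(ℤ/Lℤ)^d`, for `c_{1/2} ≥ 0` and a twist set `V` of plaquettes bisected by the
reflection hyperplanes, `Z⁻_Λ(V) ≤ Z_Λ` — here as `Z - Z⁻ = 2 Σ_{|Q| odd} T_Q ≥ 0`.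
[cite: Tomboulis2007Confinement, Prop. IV.1 eq. (4.6); App. A §5] -/
theorem torusZtw_one_le_torusZ (hL : Even L) {c : ℕ → ℝ} (hc : 0 ≤ c 1)
    {V : Finset (Plaquette d L)} (hV : ∀ p ∈ V, IsCrossPlaq p) :
    torusZtw d L 1 c V ≤ torusZ d L 1 c := by
  have h := torusZ_sub_torusZtw_one d L c V
  have h2 : 0 ≤ ∑ Q ∈ V.powerset.filter (fun Q => Odd Q.card), tTerm c V Q :=
    Finset.sum_nonneg fun Q hQ =>
      tTerm_nonneg hL hc hV (Finset.mem_powerset.1 (Finset.mem_filter.1 hQ).1)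
  linarith

/-- **The companion bound `-Z_Λ ≤ Z⁻_Λ(V)`** (same hypotheses): `Z + Z⁻ = 2 Σ_{|Q| even} T_Q ≥ 0`, the
reflection positivity of `Z⁺ = (Z + Z⁻)/2` of arXiv:0707.2179 §4.1 (text before Prop. IV.2) on the
one-character ray. [cite: Tomboulis2007Confinement, §4.1 eq. (4.7); App. A §5] -/
theorem neg_torusZ_le_torusZtw_one (hL : Even L) {c : ℕ → ℝ} (hc : 0 ≤ c 1)
    {V : Finset (Plaquette d L)} (hV : ∀ p ∈ V, IsCrossPlaq p) :
    -torusZ d L 1 c ≤ torusZtw d L 1 c V := by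
  have h := torusZ_add_torusZtw_one d L c V
  have h2 : 0 ≤ ∑ Q ∈ V.powerset.filter (fun Q => Even Q.card), tTerm c V Q :=
    Finset.sum_nonneg fun Q hQ =>
      tTerm_nonneg hL hc hV (Finset.mem_powerset.1 (Finset.mem_filter.1 hQ).1)
  linarith

/-- **`|Z⁻_Λ(V)| ≤ Z_Λ`** on the one-character ray (the two bounds combined).
[cite: Tomboulis2007Confinement, Prop. IV.1 eq. (4.6); §4.1 eq. (4.7)] -/
theorem abs_torusZtw_one_le_torusZ (hL : Even L) {c : ℕ → ℝ} (hc : 0 ≤ c 1)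
    {V : Finset (Plaquette d L)} (hV : ∀ p ∈ V, IsCrossPlaq p) :
    |torusZtw d L 1 c V| ≤ torusZ d L 1 c :=
  abs_le.2 ⟨by linarith [neg_torusZ_le_torusZtw_one hL hc hV], torusZtw_one_le_torusZ hL hc hV⟩

omit [Fact (1 < L)] in
/-- The vortex sheet in a plane `(0, j)` containing the time axis consists of plaquettes bisected by
the reflection hyperplane `t = 1/2` (its plaquettes are the `(0, j)`-plaquettes based at `t = 0`).
[cite: Tomboulis2007Confinement, App. A §5] -/
theorem vortexSheet_isCrossPlaq (j : Fin d) (h0j : (0 : Fin d) < j) :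
    ∀ p ∈ vortexSheet L 0 j h0j, IsCrossPlaq p := by
  intro p hp
  unfold vortexSheet at hp
  rw [Finset.mem_filter] at hp
  obtain ⟨-, hp2, hp0, -⟩ := hp
  exact ⟨by rw [hp2], Or.inl (by rw [hp0, ZMod.val_zero])⟩

/-- **`TwistLe d L 1 𝒱` — Prop. IV.1 for the spin cut-off `J = 1` (one non-trivial character), on the
even torus, for the vortex sheet in a plane containing the time axis**: for every admissible
coefficient sequence (`0 ≤ c_j ≤ 1`), `Z⁻_Λ ≤ Z_Λ`. (The fact `TwistLe` of
`TomboulisVortexDecimation` quantifies over all admissible `c`; at `J = 1` only `c_{1/2} = c 1`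
enters.) [cite: Tomboulis2007Confinement, Prop. IV.1 eq. (4.6); App. A §5] -/
theorem twistLe_one_vortexSheet (hL : Even L) (j : Fin d) (h0j : (0 : Fin d) < j) :
    TwistLe d L 1 (vortexSheet L 0 j h0j) := fun _c hc =>
  torusZtw_one_le_torusZ hL (hc 1 le_rfl).1 (vortexSheet_isCrossPlaq j h0j)

/-- … and the vortex free energy ratio lies in `[-1, 1]`: `|Z⁻_Λ/Z_Λ| ≤ 1` whenever `Z_Λ ≠ 0`
(`J = 1`, even torus, sheet in a plane containing the time axis, `c_{1/2} ≥ 0`).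
[cite: Tomboulis2007Confinement, Prop. IV.1 eq. (4.6); §6 eq. (6.1)] -/
theorem abs_vortexRatio_one_le_one (hL : Even L) {c : ℕ → ℝ} (hc : 0 ≤ c 1) (j : Fin d)
    (h0j : (0 : Fin d) < j) (hZ : torusZ d L 1 c ≠ 0) :
    |vortexRatio d L 1 c (vortexSheet L 0 j h0j)| ≤ 1 := by
  have hV := vortexSheet_isCrossPlaq (L := L) j h0j
  have hZpos : 0 < torusZ d L 1 c := by
    rcases ((abs_nonneg (torusZtw d L 1 c (vortexSheet L 0 j h0j))).trans
        (abs_torusZtw_one_le_torusZ hL hc hV)).lt_or_eq with h | h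
    · exact h
    · exact absurd h.symm hZ
  unfold vortexRatio
  rw [abs_div, abs_of_pos hZpos, div_le_one hZpos]
  exact abs_torusZtw_one_le_torusZ hL hc hV

/-! ### Revision 2: every plane (transport by `VortexTwistPlaneSymmetry`) -/

/-- **Prop. IV.1 at `J = 1` for the vortex sheet in every plane**: on the even torus `(ℤ/Lℤ)^d`
(`d ≥ 2`), for every plane `(i, j)` and every admissible coefficient sequence, `Z⁻_Λ(𝒱_{ij}) ≤ Z_Λ`
(the `(0, 1)`-plane case `twistLe_one_vortexSheet` transported by the relabelling of the axes,
`twistLe_vortexSheet_iff_plane_zero_one`). [cite: Tomboulis2007Confinement, Prop. IV.1 eq. (4.6); App. A §5] -/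
theorem twistLe_one_vortexSheet_plane (hL : Even L) (h01 : (0 : Fin d) < 1) {i j : Fin d}
    (hij : i < j) : TwistLe d L 1 (vortexSheet L i j hij) :=
  (twistLe_vortexSheet_iff_plane_zero_one h01 hij 1).2 (twistLe_one_vortexSheet hL 1 h01)

/-- **`|Z⁻_Λ(𝒱_{ij})| ≤ Z_Λ` for every plane** (`J = 1`, even torus, `c_{1/2} ≥ 0`).
[cite: Tomboulis2007Confinement, Prop. IV.1 eq. (4.6); §4.1 eq. (4.7)] -/
theorem abs_torusZtw_one_vortexSheet_le_torusZ (hL : Even L) (h01 : (0 : Fin d) < 1) {c : ℕ → ℝ}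
    (hc : 0 ≤ c 1) {i j : Fin d} (hij : i < j) :
    |torusZtw d L 1 c (vortexSheet L i j hij)| ≤ torusZ d L 1 c := by
  rw [torusZtw_vortexSheet_eq_plane_zero_one h01 hij]
  exact abs_torusZtw_one_le_torusZ hL hc (vortexSheet_isCrossPlaq 1 h01)

/-- **`|Z⁻_Λ/Z_Λ| ≤ 1` for the vortex sheet in every plane** (`J = 1`, even torus, `c_{1/2} ≥ 0`,
`Z_Λ ≠ 0`). [cite: Tomboulis2007Confinement, Prop. IV.1 eq. (4.6); §6 eq. (6.1)] -/
theorem abs_vortexRatio_one_le_one_plane (hL : Even L) (h01 : (0 : Fin d) < 1) {c : ℕ → ℝ}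
    (hc : 0 ≤ c 1) {i j : Fin d} (hij : i < j) (hZ : torusZ d L 1 c ≠ 0) :
    |vortexRatio d L 1 c (vortexSheet L i j hij)| ≤ 1 := by
  rw [vortexRatio_vortexSheet_eq_plane_zero_one h01 hij]
  exact abs_vortexRatio_one_le_one hL hc 1 h01 hZ

end RP

end Tomboulis2007

end Literature.MathematicalPhysics.QuantumFieldTheory

end
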